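import Mathlib
import HarnessLib
import Summits.HubbardSuperconductivity.HubbardSuperconductivity.Theorems.KLProgrammeKLRegimeEngineAngularMass
import Summits.HubbardSuperconductivity.HubbardSuperconductivity.Theorems.KLProgrammeKLRegimeEngineV8PairTransferRelBar

/-!
# Route `KLProgramme` — ENGINE child gen 8 (stmt-HubbardSuperconductivity-20437 `KLRegimeEngineV17F2`), skeleton v2 class #5 rev 3, located item #19 «(c)-DRESSING-AVG»
# (plan g21 (R90)): the angular / windowed mass of a label weight against the RELATIVE GAIN profile `klRelGain n` — `klRelGain_le_div`, **`klam_relGain_angular_le`**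
# (cell gate-hubbard-kl, seat hubbard-kl-k3c1-p1 g11, technique «composed-map remainder propagation»)

WHY.  In the SIZES bundle of `pairTransferRelAt_succ_keyed` (p592121) the inherited bar `transferBarRelIdx … n j′` enters CONVOLUTIONS `Σ_c Tb(x,c)·|w_c|` with label weights
`w ∈ {aʰ, a(0), a(1), ρ₁, ρ₂}` (fwd ↔ relative-residue conversions; the four-term dressing of the relative Duhamel).  p1 g13 located (KL STATUS 2026-08-28T01:24Z) that on the
GAIN slots `klRelGain n (|x − c|_𝕋)`, `klRelGain n (|x + c − Qm|_𝕋)` the crude `sup × mass` bound is dead at deep `n` and the gain must be AVERAGED against the label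
distribution of `w` (windowed mass lines (W1)/(W2), EdgeFacts lane).  This file is the door-side half: the dyadic layer cake (`klam_sum_mul_profile_le`, p496685) run on the
profile `klRelGain n ρ = min(ρ/Λₙ, Λₙ/ρ)·(1 + kₙ(ρ))` —
* `klRelGain_le_div`: `klRelGain n ρ ≤ (n+2)·Λₙ/ρ` for `0 < ρ` (and `≤ n + 2` everywhere, `klRelGain_le`);
* **`klam_relGain_angular_le`**: for weights `w ≥ 0` on any finite label set with a distance-like `d` (only `d > 0` is read off the centre), total mass `≤ Z` and WINDOWED mass `Σ_{d(c) ≤ η} w_c ≤ A·η` for every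
  `η ≥ η₀` (`η₀ ≤ Λₙ`), and any number `I` of dyadic shells: `Σ_c w_c·klRelGain n (d c) ≤ (n+2)·(A·Λₙ·(1 + 2I) + Z/2^I)` — with `I = 2n` (`2^{−2n} = Λₙ/klE0`) this is p1's
  `ε_n·M_w`, `ε_n ≍ (n+2)²·Λₙ`, against the `2^{−n}` floor of the bar: the convolution closes with huge margin once (W2) supplies `A, Z` for the class-#5 weights.
Real analysis over landed lemmas; nothing about the model is asserted.  0 kit.
-/

noncomputable section

namespace Summit.HubbardSuperconductivity.HubbardSuperconductivity.Theorems.KLRegimeSplit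

set_option linter.dupNamespace false -- summit = problem name (single-conjunct summit), D-0017

open Finset Literature.MathematicalPhysics.QuantumLattice Literature.Probability.LatticeModels
open Summit.HubbardSuperconductivity.HubbardSuperconductivity.Theorems.KLProgrammeLegKernels

section RelGain

/-- Off the centre the relative gain is `≤ (n+2)·Λₙ/ρ` (`0 < ρ`). -/
theorem klRelGain_le_div (n : ℕ) {ρ : ℝ} (hρ : 0 < ρ) : klRelGain n ρ ≤ (n + 2) * klScale klE0 n / ρ := by
  unfold klRelGain
  have hΛ : 0 < klScale klE0 n := klth_klScale_pos n
  have h1 : min (ρ / klScale klE0 n) (klScale klE0 n / ρ) ≤ klScale klE0 n / ρ := min_le_right _ _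
  have h0 : 0 ≤ min (ρ / klScale klE0 n) (klScale klE0 n / ρ) := le_min (div_nonneg hρ.le hΛ.le) (div_nonneg hΛ.le hρ.le)
  have hk : (klShellCount n ρ : ℝ) ≤ n + 1 := by exact_mod_cast klShellCount_le n ρ
  have h2 : 0 ≤ 1 + (klShellCount n ρ : ℝ) := by positivity
  have hq : 0 ≤ klScale klE0 n / ρ := div_nonneg hΛ.le hρ.le
  calc min (ρ / klScale klE0 n) (klScale klE0 n / ρ) * (1 + (klShellCount n ρ : ℝ))
      ≤ klScale klE0 n / ρ * (n + 2) := mul_le_mul h1 (by linarith) h2 hq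
    _ = (n + 2) * klScale klE0 n / ρ := by ring

variable {α : Type*} [Fintype α]

/-- **Angular / windowed mass against the relative gain** (dyadic layer cake): weights `w ≥ 0` with total mass `≤ Z` and windowed mass `Σ_{d(c) ≤ η} w_c ≤ A·η` for all
`η ≥ η₀`, `η₀ ≤ Λₙ`; then for every `I`, `Σ_c w_c·klRelGain n (d c) ≤ (n+2)·(A·Λₙ·(1 + 2·I) + Z/2^I)`. -/
theorem klam_relGain_angular_le (w d : α → ℝ) (n I : ℕ) {η₀ A Z : ℝ} (hw : ∀ c, 0 ≤ w c)
    (hη₀ : η₀ ≤ klScale klE0 n) (hmass : ∀ η : ℝ, η₀ ≤ η → ∑ c ∈ univ.filter (fun c => d c ≤ η), w c ≤ A * η) (hZ : ∑ c, w c ≤ Z) :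
    ∑ c, w c * klRelGain n (d c) ≤ (n + 2) * (A * klScale klE0 n * (1 + 2 * I) + Z / 2 ^ I) := by
  have hΛ : 0 < klScale klE0 n := klth_klScale_pos n
  have hn2 : (0 : ℝ) ≤ n + 2 := by positivity
  have h := klam_sum_mul_profile_le w (fun c => klRelGain n (d c)) d I (η₀ := η₀) (A := A) (Z := Z)
    (C := (n + 2) * klScale klE0 n) (f := 0) (Φ₀ := n + 2) (r₀ := klScale klE0 n)
    hw (by positivity) le_rfl hn2 hΛ hη₀ hmass hZ (fun c => klRelGain_le n (d c)) (fun c hc => by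
      simpa using klRelGain_le_div n hc)
  refine h.trans (le_of_eq ?_)
  field_simp
  ring

/-- The same with the canonical shell number `I = 2n` (`2^{2n} = 4^n`): `Σ_c w_c·klRelGain n (d c) ≤ (n+2)·(A·Λₙ·(1 + 4n) + Z·4^{−n})`. -/
theorem klam_relGain_angular_le_two_mul (w d : α → ℝ) (n : ℕ) {η₀ A Z : ℝ} (hw : ∀ c, 0 ≤ w c)
    (hη₀ : η₀ ≤ klScale klE0 n) (hmass : ∀ η : ℝ, η₀ ≤ η → ∑ c ∈ univ.filter (fun c => d c ≤ η), w c ≤ A * η) (hZ : ∑ c, w c ≤ Z) :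
    ∑ c, w c * klRelGain n (d c) ≤ (n + 2) * (A * klScale klE0 n * (1 + 4 * n) + Z * ((4 : ℝ) ^ n)⁻¹) := by
  have h := klam_relGain_angular_le w d n (2 * n) hw hη₀ hmass hZ
  have h4 : (2 : ℝ) ^ (2 * n) = (4 : ℝ) ^ n := by rw [pow_mul]; norm_num
  rw [h4] at h
  refine h.trans (le_of_eq ?_)
  push_cast
  rw [div_eq_mul_inv]
  ring

end RelGain

end Summit.HubbardSuperconductivity.HubbardSuperconductivity.Theorems.KLRegimeSplit

end
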